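import Summits.ResolutionOfSingularities.ResolutionOfSingularities.Theorems.FrobeniusClosingPatchingRelPerfectDepthOneCompanion
import Summits.ResolutionOfSingularities.ResolutionOfSingularities.Theorems.FrobeniusClosingPatchingRelPerfectDepthOne
import HarnessLib

/-!
# Crux `PatchingRelPerfect` (stmt-ResolutionOfSingularities-16161), chain W5.2 — rungs r-d1ʳ / r-d1^Q MODULO THE TWO
# NAMED FACTS ONLY, and the composition of record with the depth-one stratum discharged (lead prover, gen 3)

[OURS · L1 W5.2 · lead] Replaces the role of NO printed item; NOT a statement of the manuscript under review.

With r-d1 ASSEMBLED (`depthOne`, `depthOne_companion`, res-L1-w52-lead-2, `…DepthOne.lean`) the typed-target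
hypotheses of `…DepthOneCompanion.lean` (this seat, p497614) are discharged BY NAME; what remains are the two printed
dimension-three facts CP = `CossartPiltant2019Principalization` (F-31) and CJS-B =
`CossartJannsenSaito2020EmbeddedSequenceB` (F-32bR), taken as hypotheses (CONDITIONAL results):

* `coreRung_reduction_of_depthOne_of_facts` — **rung r-d1ʳ**: every `I ≠ 0` with `I · Kʳ = Kʳ⁺¹` for SOME depth-one
  `K` (equivalently: the integral closure of `I` is of exceptional depth one) satisfies the conclusion of the open core
  for every blowing up along `I` — a stratum strictly larger than r-d1's;
* `coreRung_of_mul_primary_depthOne_of_facts` — **rung r-d1^Q**: so does every `I ≠ 0` with `I · Q₀` of depth one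
  for some `𝔪`-primary `Q₀`;
* `patchingRelPerfect_of_namedFacts_of_deeper_of_dimGeFive` — the crux BY NAME from FOUR named facts of the tree
  (`CossartPiltant2019General`, `CossartPiltant2019Principalization`, `CossartJannsenSaito2020Sequence`,
  `CossartJannsenSaito2020EmbeddedSequenceB`), the open core RESTRICTED TO THE COMPLEMENT OF THE DEPTH-ONE STRATUM,
  and the parked dimension-`≥ 5` residual: the certificate `patchingRelPerfect_of_printed_of_depthOne_of_deeper_of_dimGeFive`
  (p497614) with `DepthOneConclusion` discharged by `depthOne`. CONDITIONAL; the item stays open; no standing of the core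
  is claimed; the complement stratum is a HYPOTHESIS (nothing is restated weaker).

AI-written; weaker than expert review.

## References
* V. Cossart, O. Piltant, J. Algebra 529 (2019), Thm. 1.1, Prop. 4.4. [CossartPiltant2019]
* V. Cossart, U. Jannsen, S. Saito, LNM 2270 (2020), Thm. 1.2, Thm. 1.4, Thm. 6.9 (a). [CossartJannsenSaito2020]
* The Stacks Project, Tag 080A. [StacksProject]
-/

-- `Summit.<Summit>.<Sub>.Theorems` with `Sub = Summit` (single-conjunct summit, D-0017)
set_option linter.dupNamespace false

noncomputable section

open CategoryTheory CategoryTheory.Limits AlgebraicGeometry TopologicalSpace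
open Literature.AlgebraicGeometry.Resolution

namespace Summit.ResolutionOfSingularities.ResolutionOfSingularities.Theorems

universe u

namespace DepthOneTargets

/-- [OURS · L1 W5.2 · lead] **Rung r-d1ʳ modulo CP and CJS-B only**: `S` regular local of Krull dimension four,
`x` spanning `𝔪`, `K` of exceptional depth one, `I ≠ 0` with `I · Kʳ = Kʳ⁺¹`; then every blowing up
`f : T ⟶ Spec S` along `I` carries a non-zero ideal sheaf cosupported in the closed fibre with regular blowing up
(companion `Kʳ · Q_K`). CONDITIONAL on the two named facts. [cite: CossartPiltant2019, Prop. 4.4]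
[cite: CossartJannsenSaito2020, Thm. 1.4, Thm. 6.9 (a)] [cite: StacksProject, Tag 080A] -/
theorem coreRung_reduction_of_depthOne_of_facts (hCP : CossartPiltant2019Principalization.{u})
    (hCJS : CossartJannsenSaito2020EmbeddedSequenceB.{u})
    {S : Type u} [CommRing S] [IsRegularLocalRing S] (hdim : ringKrullDim S = (4 : ℕ))
    {n : ℕ} (x : Fin n → S) (hx : Ideal.span (Set.range x) = IsLocalRing.maximalIdeal S)
    {K : Ideal S} (hK : HasExceptionalDepthOne x K) {I : Ideal S} (hI : I ≠ ⊥) {r : ℕ}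
    (hIK : I * K ^ r = K ^ (r + 1))
    (T : Scheme.{u}) (f : T ⟶ Spec (.of S)) (hf : IsBlowup f (affineBlowup.idealSheaf I)) :
    ∃ (J : T.IdealSheafData) (T' : Scheme.{u}) (π : T' ⟶ T), J ≠ ⊥ ∧
      (∀ t : T, t ∈ J.support → f.base t = IsLocalRing.closedPoint S) ∧
      IsBlowup π J ∧ Scheme.IsRegular T' := by
  obtain ⟨m, hKm⟩ := hK.exists_pow_maximalIdeal_le hx
  exact coreRung_reduction_of_companion hI hKm hIK
    (depthOne_companion hCP hCJS S hdim x hx K (hK.ne_bot hdim hx) hK) T f hf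

/-- [OURS · L1 W5.2 · lead] **Rung r-d1^Q modulo CP and CJS-B only**: if `I ≠ 0` and `I · Q₀` is of exceptional
depth one for some `𝔪`-primary `Q₀ ⊇ 𝔪^{m₀}`, every blowing up of `Spec S` along `I` satisfies the core's
conclusion (companion `Q₀ · Q`). CONDITIONAL on the two named facts. [cite: CossartPiltant2019, Prop. 4.4]
[cite: CossartJannsenSaito2020, Thm. 1.4, Thm. 6.9 (a)] [cite: StacksProject, Tag 080A] -/
theorem coreRung_of_mul_primary_depthOne_of_facts (hCP : CossartPiltant2019Principalization.{u})
    (hCJS : CossartJannsenSaito2020EmbeddedSequenceB.{u})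
    {S : Type u} [CommRing S] [IsRegularLocalRing S] (hdim : ringKrullDim S = (4 : ℕ))
    {n : ℕ} (x : Fin n → S) (hx : Ideal.span (Set.range x) = IsLocalRing.maximalIdeal S)
    {I Q₀ : Ideal S} (hI : I ≠ ⊥) {m₀ : ℕ} (hQ₀ : IsLocalRing.maximalIdeal S ^ m₀ ≤ Q₀)
    (hIQ₀ : HasExceptionalDepthOne x (I * Q₀))
    (T : Scheme.{u}) (f : T ⟶ Spec (.of S)) (hf : IsBlowup f (affineBlowup.idealSheaf I)) :
    ∃ (J : T.IdealSheafData) (T' : Scheme.{u}) (π : T' ⟶ T), J ≠ ⊥ ∧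
      (∀ t : T, t ∈ J.support → f.base t = IsLocalRing.closedPoint S) ∧
      IsBlowup π J ∧ Scheme.IsRegular T' := by
  obtain ⟨Q, m, hQm, B, b, hb, hB⟩ :=
    depthOne_companion hCP hCJS S hdim x hx (I * Q₀) (hIQ₀.ne_bot hdim hx) hIQ₀
  refine atomConclusion_of_companion' hI ⟨Q₀ * Q, m₀ + m, ?_, B, b, ?_, hB⟩ T f hf
  · rw [pow_add]
    exact Ideal.mul_mono hQ₀ hQm
  · rwa [← mul_assoc]

end DepthOneTargets

open DepthOneTargets

/-- [OURS · L1 W5.2 · lead] **The crux `FrobeniusClosing.PatchingRelPerfect` BY NAME from four named facts of the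
tree, the open core ON THE COMPLEMENT OF THE DEPTH-ONE STRATUM, and the dimension-`≥ 5` residual** — the
certificate `patchingRelPerfect_of_printed_of_depthOne_of_deeper_of_dimGeFive` with the depth-one rung DISCHARGED
by `depthOne` (r-d1 assembled) and the dimension-`≤ 2` desingularization conjunct taken from
`CossartJannsenSaito2020Sequence` (`cjs2020BlowupFormat_of_cossartJannsenSaito2020Sequence`). The complement
stratum: complete regular local `S` of dimension four, characteristic `p`, perfect residue field, `I ≠ 0` with
blowing up regular off `V(𝔪)` and of exceptional depth one in NO finite family spanning `𝔪`. CONDITIONAL; the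
item stays open. [cite: CossartPiltant2019, Thm. 1.1 and Prop. 4.4]
[cite: CossartJannsenSaito2020, Thm. 1.2, Thm. 1.4, Thm. 6.9 (a)] -/
theorem patchingRelPerfect_of_namedFacts_of_deeper_of_dimGeFive
    (hG : CossartPiltant2019General.{0}) (hP : CossartPiltant2019Principalization.{0})
    (hS : CossartJannsenSaito2020Sequence.{0}) (hCJSB : CossartJannsenSaito2020EmbeddedSequenceB.{0})
    (hdeep : ∀ (p : ℕ), p.Prime → ∀ (S : Type) [CommRing S] [IsRegularLocalRing S] [CharP S p]
      [IsAdicComplete (IsLocalRing.maximalIdeal S) S]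
      [PerfectField (IsLocalRing.ResidueField S)], ringKrullDim S = (4 : ℕ) →
      ∀ (I : Ideal S), I ≠ ⊥ →
        (∀ (n : ℕ) (x : Fin n → S), Ideal.span (Set.range x) = IsLocalRing.maximalIdeal S →
          ¬ HasExceptionalDepthOne x I) →
        ∀ (T : Scheme.{0}) (f : T ⟶ Spec (.of S)),
        IsBlowup f (affineBlowup.idealSheaf I) →
        (∀ t : T, f.base t ≠ IsLocalRing.closedPoint S → IsRegularLocalRing (T.presheaf.stalk t)) →
        ∃ (J : T.IdealSheafData) (T' : Scheme.{0}) (π : T' ⟶ T), J ≠ ⊥ ∧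
          (∀ t : T, t ∈ J.support → f.base t = IsLocalRing.closedPoint S) ∧
          IsBlowup π J ∧ Scheme.IsRegular T')
    (h5 : ∀ (p : ℕ), p.Prime →
      (∀ (k K : Type) [Field k] [CharP k p] [PerfectField k] [Field K] [Algebra k K],
        (⊤ : IntermediateField k K).FG → ∀ O : ValuationSubring K, (∀ c : k, algebraMap k K c ∈ O) →
          ∀ R : Subalgebra k K, R.FG → R.toSubring ≤ O.toSubring →
            ∃ (A : Subalgebra k K) (h : A.toSubring ≤ O.toSubring), R ≤ A ∧ A.FG ∧
              IsFractionRing A K ∧ IsRegularLocalRing (Localization.AtPrime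
                (Ideal.comap (Subring.inclusion h) (IsLocalRing.maximalIdeal O)))) →
      ∀ (k : Type) [Field k] [CharP k p] [PerfectField k] (X : Scheme.{0}) (f : X ⟶ Spec (.of k)),
        IsSeparated f → LocallyOfFiniteType f → QuasiCompact f → IsIntegral X →
        ¬ topologicalKrullDim X ≤ 4 → Scheme.HasResolution X) :
    Summit.ResolutionOfSingularities.ResolutionOfSingularities.Theses.FrobeniusClosing.PatchingRelPerfect :=
  patchingRelPerfect_of_printed_of_depthOne_of_deeper_of_dimGeFive hG hP
    (cjs2020BlowupFormat_of_cossartJannsenSaito2020Sequence hS) (depthOne hP hCJSB) hdeep h5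

end Summit.ResolutionOfSingularities.ResolutionOfSingularities.Theorems

end
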